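import Mathlib
/-! # Stub `stub_dissocRecords` — crux `TwoProducts` (stmt-ValiantsHypothesis-5906), line `corner-log-linearization`
   RECORD LEMMA of the dissociated regime.  Atoms `c i : α → ℂ` (`i : Fin N`), signs `lam i`, and the moment of a
   multiset `m : α →₀ ℕ` of letters `μ̂(m) = Σ_i lam i · ∏_a (c i a)^(m a)`.  If `μ̂(ms) ≠ 0` while every other
   multiset on the letter set `U ⊇ supp ms` of weight `≤ weight(ms)` (`weight(m) = Σ_a (m a) · W a`, `W ≥ 0` on `U`)
   has vanishing moment, then (b) `|ms| + 1 ≤ N` and (a) every letter `a` of `ms` is a greedy record: its column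
   `i ↦ c i a` is not in the `ℂ`-span of the all-ones vector and the columns of the letters `b ∈ U`, `b ≠ a`,
   `W b ≤ W a`.  Both parts apply a linear functional `x ↦ Σ_i lam i · x i · (c i)^t` (multiplicativity of the
   monomial evaluation `m ↦ (c i)^m`): for (a) it kills the spanning set but not the column of `a`
   (`t = ms - single a 1`); for (b) the evaluations `(c ·)^m`, `m ≤ ms`, are linearly independent in `Fin N → ℂ`
   (take `t = ms - m₁` for a maximal-weight `m₁` in a vanishing combination), and the box `{m ≤ ms}` has
   `∏ (ms a + 1) ≥ |ms| + 1` elements. [folklore] -/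
set_option linter.dupNamespace false -- single-conjunct summit: `ValiantsHypothesis.ValiantsHypothesis`
namespace Summit.ValiantsHypothesis.ValiantsHypothesis.Theorems.TwoProducts.DissocRecords
open scoped BigOperators

variable {α : Type*}

/-- The monomial evaluation `m ↦ x^m = ∏_a (x a)^(m a)` is multiplicative. [folklore] -/
theorem prod_pow_add {M : Type*} [CommMonoid M] (x : α → M) (m m' : α →₀ ℕ) :
    ((m + m').prod fun a k => x a ^ k) = (m.prod fun a k => x a ^ k) * m'.prod fun a k => x a ^ k :=
  Finsupp.prod_add_index' (fun a => pow_zero (x a)) fun a k l => pow_add (x a) k l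

/-- The monomial evaluation at a single letter: `x^(single a 1) = x a`. [folklore] -/
theorem prod_pow_single {M : Type*} [CommMonoid M] (x : α → M) (a : α) :
    ((Finsupp.single a (1 : ℕ)).prod fun b k => x b ^ k) = x a := by
  simp

/-- The weight `m ↦ Σ_a (m a) · W a` is additive. [folklore] -/
theorem wt_add (W : α → ℤ) (m m' : α →₀ ℕ) :
    ((m + m').sum fun a k => (k : ℤ) * W a) =
      (m.sum fun a k => (k : ℤ) * W a) + m'.sum fun a k => (k : ℤ) * W a :=
  Finsupp.sum_add_index' (fun a => by simp) fun a k l => by push_cast; ring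

/-- The weight of a single letter is `W a`. [folklore] -/
theorem wt_single (W : α → ℤ) (a : α) :
    ((Finsupp.single a (1 : ℕ)).sum fun b k => (k : ℤ) * W b) = W a := by
  simp

/-- The linear functional `x ↦ Σ_j x j · (lam j · (c j)^t)` sends the evaluation `(c ·)^m` to the moment of
`m + t`. [folklore] -/
theorem linComb_ev {N : ℕ} (c : Fin N → α → ℂ) (lam : Fin N → ℂ) (t m : α →₀ ℕ) :
    Fintype.linearCombination ℂ (fun j => lam j * t.prod fun b k => c j b ^ k)
        (fun j => m.prod fun a k => c j a ^ k) =
      ∑ j, lam j * (m + t).prod fun a k => c j a ^ k := by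
  rw [Fintype.linearCombination_apply]
  refine Finset.sum_congr rfl fun j _ => ?_
  rw [prod_pow_add, smul_eq_mul]
  ring

/-- The linear functional `x ↦ Σ_j x j · (lam j · (c j)^t)` sends the column of the letter `b` to the moment of
`single b 1 + t`. [folklore] -/
theorem linComb_col {N : ℕ} (c : Fin N → α → ℂ) (lam : Fin N → ℂ) (t : α →₀ ℕ) (b : α) :
    Fintype.linearCombination ℂ (fun j => lam j * t.prod fun b k => c j b ^ k) (fun j => c j b) =
      ∑ j, lam j * (Finsupp.single b 1 + t).prod fun a k => c j a ^ k := by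
  rw [← linComb_ev c lam t (Finsupp.single b 1)]
  simp_rw [prod_pow_single]

/-- The linear functional `x ↦ Σ_j x j · (lam j · (c j)^t)` sends the all-ones vector to the moment of `t`.
[folklore] -/
theorem linComb_one {N : ℕ} (c : Fin N → α → ℂ) (lam : Fin N → ℂ) (t : α →₀ ℕ) :
    Fintype.linearCombination ℂ (fun j => lam j * t.prod fun b k => c j b ^ k) (fun _ => (1 : ℂ)) =
      ∑ j, lam j * t.prod fun a k => c j a ^ k := by
  rw [Fintype.linearCombination_apply]
  refine Finset.sum_congr rfl fun j _ => ?_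
  rw [smul_eq_mul, one_mul]

/-- For naturals, `Σ_{a ∈ s} f a + 1 ≤ ∏_{a ∈ s} (f a + 1)`. [folklore] -/
theorem sum_add_one_le_prod_succ (s : Finset α) (f : α → ℕ) :
    (∑ a ∈ s, f a) + 1 ≤ ∏ a ∈ s, (f a + 1) := by
  classical
  induction s using Finset.induction_on with
  | empty => simp
  | insert a s has ih =>
    rw [Finset.sum_insert has, Finset.prod_insert has]
    have h1 : 0 < ∏ x ∈ s, (f x + 1) := Finset.prod_pos fun x _ => Nat.succ_pos _
    calc f a + ∑ x ∈ s, f x + 1 = f a + (∑ x ∈ s, f x + 1) := by ring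
      _ ≤ f a * ∏ x ∈ s, (f x + 1) + ∏ x ∈ s, (f x + 1) :=
        add_le_add (Nat.le_mul_of_pos_right _ h1) ih
      _ = (f a + 1) * ∏ x ∈ s, (f x + 1) := by ring

/-- RECORD LEMMA, part (a): every letter of the live multiset `ms` is a greedy record. [folklore] -/
theorem not_mem_span_of_dead {N : ℕ} (c : Fin N → α → ℂ) (lam : Fin N → ℂ) (U : Finset α)
    (W : α → ℤ) (ms : α →₀ ℕ) (hW : ∀ a ∈ U, 0 ≤ W a) (hms : ms.support ⊆ U)
    (hne : (∑ i, lam i * ms.prod (fun a k => c i a ^ k)) ≠ 0)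
    (hdead : ∀ m : α →₀ ℕ, m.support ⊆ U → m ≠ ms →
      (m.sum fun a k => (k : ℤ) * W a) ≤ (ms.sum fun a k => (k : ℤ) * W a) →
      (∑ i, lam i * m.prod (fun a k => c i a ^ k)) = 0)
    (a : α) (ha : a ∈ ms.support) :
    (fun i => c i a) ∉ Submodule.span ℂ
      (insert (fun _ : Fin N => (1 : ℂ)) ((fun b : α => fun i : Fin N => c i b) ''
        {b : α | b ∈ U ∧ b ≠ a ∧ W b ≤ W a})) := by
  classical
  intro hspan
  have ha1 : 1 ≤ ms a := Nat.one_le_iff_ne_zero.mpr (Finsupp.mem_support_iff.mp ha)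
  have haU : a ∈ U := hms ha
  have hrms : Finsupp.single a 1 + (ms - Finsupp.single a 1) = ms :=
    add_tsub_cancel_of_le (Finsupp.single_le_iff.mpr ha1)
  have hra : (ms - Finsupp.single a 1 : α →₀ ℕ) a = ms a - 1 := by
    rw [Finsupp.tsub_apply, Finsupp.single_eq_same]
  have hrU : (ms - Finsupp.single a 1).support ⊆ U := Finsupp.support_tsub.trans hms
  have hwr : (ms.sum fun a k => (k : ℤ) * W a) =
      W a + (ms - Finsupp.single a 1).sum fun a k => (k : ℤ) * W a := by
    have := wt_add W (Finsupp.single a 1) (ms - Finsupp.single a 1)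
    rwa [hrms, wt_single] at this
  generalize ms - Finsupp.single a 1 = r at hrms hra hrU hwr
  have hker : insert (fun _ : Fin N => (1 : ℂ)) ((fun b : α => fun i : Fin N => c i b) ''
        {b : α | b ∈ U ∧ b ≠ a ∧ W b ≤ W a}) ⊆
      (LinearMap.ker (Fintype.linearCombination ℂ (fun j => lam j * r.prod fun b k => c j b ^ k)) :
        Set (Fin N → ℂ)) := by
    intro x hx
    rw [SetLike.mem_coe, LinearMap.mem_ker]
    rcases hx with rfl | ⟨b, ⟨hbU, hba, hWb⟩, rfl⟩
    · rw [linComb_one]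
      refine hdead r hrU ?_ ?_
      · intro h
        rw [h] at hra
        omega
      · rw [hwr]
        linarith [hW a haU]
    · rw [linComb_col]
      refine hdead _ ?_ ?_ ?_
      · intro x hx
        rcases Finset.mem_union.mp (Finsupp.support_add hx) with hx | hx
        · rw [Finset.mem_singleton.mp (Finsupp.support_single_subset hx)]
          exact hbU
        · exact hrU hx
      · intro h
        have := DFunLike.congr_fun h a
        rw [Finsupp.add_apply, Finsupp.single_apply, if_neg hba, hra] at this
        omega
      · rw [wt_add, wt_single, hwr]
        linarith
  have hmem := Submodule.span_le.mpr hker hspan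
  rw [LinearMap.mem_ker, linComb_col, hrms] at hmem
  exact hne hmem

/-- RECORD LEMMA, part (b): the evaluations of the box `{m ≤ ms}` are linearly independent in `Fin N → ℂ`,
so `|ms| + 1 ≤ ∏ (ms a + 1) ≤ N`. [folklore] -/
theorem sum_add_one_le_of_dead {N : ℕ} (c : Fin N → α → ℂ) (lam : Fin N → ℂ) (U : Finset α)
    (W : α → ℤ) (ms : α →₀ ℕ) (hms : ms.support ⊆ U)
    (hne : (∑ i, lam i * ms.prod (fun a k => c i a ^ k)) ≠ 0)
    (hdead : ∀ m : α →₀ ℕ, m.support ⊆ U → m ≠ ms →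
      (m.sum fun a k => (k : ℤ) * W a) ≤ (ms.sum fun a k => (k : ℤ) * W a) →
      (∑ i, lam i * m.prod (fun a k => c i a ^ k)) = 0) :
    (ms.sum fun _ k => k) + 1 ≤ N := by
  classical
  have key : ∀ g : ↥(Finset.Iic ms) → ℂ,
      (∑ i, g i • fun j => (i : α →₀ ℕ).prod fun a k => c j a ^ k) = 0 → ∀ i, g i = 0 := by
    intro g hg i₀
    by_contra hi₀
    have hTne : (Finset.univ.filter fun i => g i ≠ 0).Nonempty :=
      ⟨i₀, Finset.mem_filter.mpr ⟨Finset.mem_univ _, hi₀⟩⟩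
    obtain ⟨i₁, hi₁T, hmax⟩ := Finset.exists_max_image _
      (fun i : ↥(Finset.Iic ms) => (i : α →₀ ℕ).sum fun a k => (k : ℤ) * W a) hTne
    have hg₁ : g i₁ ≠ 0 := (Finset.mem_filter.mp hi₁T).2
    have hle₁ : (i₁ : α →₀ ℕ) ≤ ms := Finset.mem_Iic.mp i₁.2
    have hms₁ : (i₁ : α →₀ ℕ) + (ms - i₁) = ms := add_tsub_cancel_of_le hle₁
    have htU : (ms - (i₁ : α →₀ ℕ)).support ⊆ U := Finsupp.support_tsub.trans hms
    generalize ms - (i₁ : α →₀ ℕ) = t at hms₁ htU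
    -- deadness of `i + t` for `i ≠ i₁` with `g i ≠ 0`
    have hvan : ∀ i : ↥(Finset.Iic ms), i ≠ i₁ →
        g i • (∑ j, lam j * ((i : α →₀ ℕ) + t).prod fun a k => c j a ^ k) = 0 := by
      intro i hi
      by_cases hgi : g i = 0
      · rw [hgi, zero_smul]
      rw [hdead _ ?_ ?_ ?_, smul_zero]
      · intro x hx
        rcases Finset.mem_union.mp (Finsupp.support_add hx) with hx | hx
        · exact hms (Finsupp.support_mono (Finset.mem_Iic.mp i.2) hx)
        · exact htU hx
      · intro h
        exact hi (Subtype.ext (add_right_cancel (h.trans hms₁.symm)))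
      · have e1 := wt_add W (i : α →₀ ℕ) t
        have e2 := wt_add W (i₁ : α →₀ ℕ) t
        rw [hms₁] at e2
        have hwi : ((i : α →₀ ℕ).sum fun a k => (k : ℤ) * W a) ≤
            (i₁ : α →₀ ℕ).sum fun a k => (k : ℤ) * W a :=
          hmax i (Finset.mem_filter.mpr ⟨Finset.mem_univ _, hgi⟩)
        linarith
    have h0 := congrArg (Fintype.linearCombination ℂ (fun j => lam j * t.prod fun b k => c j b ^ k)) hg
    rw [map_sum, map_zero] at h0
    simp_rw [map_smul, linComb_ev c lam t] at h0
    rw [Fintype.sum_eq_single i₁ hvan, hms₁, smul_eq_mul] at h0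
    exact mul_ne_zero hg₁ hne h0
  have hli : LinearIndependent ℂ
      (fun m : ↥(Finset.Iic ms) => fun j => (m : α →₀ ℕ).prod fun a k => c j a ^ k) :=
    Fintype.linearIndependent_iff.mpr key
  have hcard := hli.fintype_card_le_finrank
  simp only [Fintype.card_coe, Finsupp.card_Iic, Nat.card_Iic, Module.finrank_fin_fun] at hcard
  calc (ms.sum fun _ k => k) + 1 = (∑ a ∈ ms.support, ms a) + 1 := rfl
    _ ≤ ∏ a ∈ ms.support, (ms a + 1) := sum_add_one_le_prod_succ _ _
    _ ≤ N := hcard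

/-- RECORD LEMMA (dissociated regime): if `μ̂(ms) ≠ 0` and every other multiset on `U` of weight `≤ weight(ms)`
is dead, then `|ms| + 1 ≤ N` and every letter of `ms` is a greedy record. [folklore] -/
theorem stub_dissocRecords : ∀ (N : ℕ) (c : Fin N → (Fin 2 →₀ ℕ) → ℂ) (lam : Fin N → ℂ) (U : Finset (Fin 2 →₀ ℕ))
    (W : (Fin 2 →₀ ℕ) → ℤ) (ms : (Fin 2 →₀ ℕ) →₀ ℕ),
    (∀ a ∈ U, 0 ≤ W a) → ms.support ⊆ U →
    (∑ i, lam i * ms.prod (fun a k => c i a ^ k)) ≠ 0 →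
    (∀ m : (Fin 2 →₀ ℕ) →₀ ℕ, m.support ⊆ U → m ≠ ms →
      (m.sum fun a k => (k : ℤ) * W a) ≤ (ms.sum fun a k => (k : ℤ) * W a) →
      (∑ i, lam i * m.prod (fun a k => c i a ^ k)) = 0) →
    (ms.sum fun _ k => k) + 1 ≤ N ∧
    ∀ a ∈ ms.support, (fun i => c i a) ∉ Submodule.span ℂ
      (insert (fun _ : Fin N => (1 : ℂ)) ((fun b : Fin 2 →₀ ℕ => fun i : Fin N => c i b) ''
        {b : Fin 2 →₀ ℕ | b ∈ U ∧ b ≠ a ∧ W b ≤ W a})) :=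
  fun _ c lam U W ms hW hms hne hdead =>
    ⟨sum_add_one_le_of_dead c lam U W ms hms hne hdead,
      fun a ha => not_mem_span_of_dead c lam U W ms hW hms hne hdead a ha⟩

end Summit.ValiantsHypothesis.ValiantsHypothesis.Theorems.TwoProducts.DissocRecords
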